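import Mathlib
import Summits.Schanuel.Schanuel.Theses.RelationCounting
import Literature.NumberTheory.Transcendental.DerivationExtension
import Literature.NumberTheory.Transcendental.KirbyEDerivations
import Literature.NumberTheory.Transcendental.ZilberFieldExistenceProofs

/-!
# Crux `CountingGapHigher` (stmt-Schanuel-16237) — every counted point is a Schanuel counterexample

Negative-lane support landed by the crux-attack refuter (vetting sweep, `--supports`).  The route
`RelationCounting` counts the points `w ∈ ℂ^M` of a strip box carrying `k + 1` ℚ-linearly
independent coordinates and `s ≥ 2M − k` integer polynomial relations at `(w, e^w)` with
ℂ-linearly independent gradients.  Its KILL CRITERION (i) reads: "if the presentation clauses do NOT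
force `trdeg ℚ(w, e^w) ≤ k` in Lean's reading of the clauses, generic swarms make both cruxes FALSE
outright".  This file settles the criterion in the negative, kernel-checked:

* `natCast_add_le_card_of_jacobian` — **Jacobian criterion**: if `s` integer polynomials vanish at
  `v ∈ ℂ^σ` with ℂ-linearly independent gradients at `v`, then `m ≤ trdeg ℚ(v)` forces
  `m + s ≤ #σ`, i.e. `trdeg ℚ(v) ≤ #σ − s` (dual derivations `∂/∂t` for an algebraically
  independent sub-family `t ⊆ v` — tree `exists_derivation_of_algebraicIndependent` — kill every
  relation by the chain rule — tree `derivation_mvPolynomial_aeval` — so the gradients lie in the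
  kernel of the surjection `g ↦ (Σᵢ gᵢ ∂_t vᵢ)_t : ℂ^σ → ℂ^m`, of dimension `#σ − m`).
* `not_schanuel_of_counted` — hence a tuple `w ∈ ℂ^M` with `k + 1` ℚ-linearly independent
  coordinates and `s ≥ 2M − k` integer relations at `(w, e^w)` with independent gradients REFUTES
  Schanuel's conjecture (`trdeg ℚ(w, e^w) ≤ 2M − s ≤ k < k + 1 ≤` rank); this covers the counted
  sets of `CountingGapHigher` (every `k ≥ 2`), of `CountingGapPair` (`k = 1`) and of `Amplification`.
* Consequently **Schanuel's conjecture implies the crux** (the counted sets are empty; width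
  `M = k + 2`, exponent `κ = 0 < k`, constant `C = 0` do): the crux is irrefutable short of
  `¬` Schanuel, and the box / degree / height / Khovanskii clauses play no role in that.  The
  three-line derivation `Schanuel → CountingGapHigher` is deliberately NOT declared here (a positive
  route-item conclusion is a prover's landing); it is attached to the item as evidence
  (`SchanuelImpliesCountingGapHigher.lean`, crux-attack seat 2026-08-17).

## References

* M. Rosenlicht, *On Liouville's theory of elementary functions*, Pacific J. Math. 65 (1976),
  Prop. 3 (the `dx_α` of a transcendence basis are a basis of `Ω_{K/k}`; dual form in the tree).
* S. Lang, *Introduction to transcendental numbers* (1966), pp. 30–31 (Schanuel's conjecture).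
-/

noncomputable section

set_option linter.dupNamespace false

open Complex Set
open Literature.NumberTheory.Transcendental

namespace Summit.Schanuel.Schanuel.Theorems.CountingGapHigher.Negative

/-- **Jacobian criterion.**  If `s` integer polynomials `P j` vanish at `v : σ → ℂ` and their
gradients at `v` are ℂ-linearly independent, then every natural number `m ≤ trdeg ℚ(v)` satisfies
`m + s ≤ #σ`; in words, `trdeg_ℚ ℚ(v) ≤ #σ − s`. [cite: Rosenlicht1976, Prop. 3] [folklore] -/
theorem natCast_add_le_card_of_jacobian {σ : Type*} [Fintype σ] [DecidableEq σ] (v : σ → ℂ)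
    {s : ℕ} (P : Fin s → MvPolynomial σ ℤ) (hP : ∀ j, MvPolynomial.aeval v (P j) = 0)
    (hG : LinearIndependent ℂ
      (fun j => fun i : σ => MvPolynomial.aeval v (MvPolynomial.pderiv i (P j))))
    {m : ℕ} (hm : (m : Cardinal) ≤ Algebra.trdeg ℚ ↥(IntermediateField.adjoin ℚ (range v))) :
    m + s ≤ Fintype.card σ := by
  classical
  -- an algebraically independent subset `J ⊆ range v` with `m` elements
  have hm' : (m : ℕ∞) ≤ (GammaField.algMatroid ℂ).eRk (range v) :=
    ZilberHomogeneity.natCast_le_eRk_of_le_trdeg hm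
  obtain ⟨J, hJsub, hJind, hJcard⟩ := Matroid.le_eRk_iff.1 hm'
  have hJfin : J.Finite := Set.finite_of_encard_eq_coe hJcard
  haveI : Fintype J := hJfin.fintype
  have hcardJ : Fintype.card J = m := by
    have h := hJcard
    rw [Set.encard_eq_coe_toFinset_card, Set.toFinset_card] at h
    exact_mod_cast h
  have hJind' : AlgebraicIndependent ℚ ((↑) : J → ℂ) :=
    AlgebraicIndependent.matroid_indep_iff.1 hJind
  -- indices of the elements of `J`
  have hpre : ∀ j : J, ∃ i : σ, v i = (j : ℂ) := fun j => hJsub j.2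
  choose l hl using hpre
  -- the dual derivations `∂/∂j₀`, `j₀ ∈ J`
  have hD : ∀ j₀ : J, ∃ D : Derivation ℚ ℂ ℂ, ∀ j : J, D (j : ℂ) = if j = j₀ then 1 else 0 :=
    fun j₀ => exists_derivation_of_algebraicIndependent hJind' _
  choose D hD using hD
  -- the linear map `Φ g = (∑ i, g i * ∂_{j₀} (v i))_{j₀}`
  let Φ : (σ → ℂ) →ₗ[ℂ] (J → ℂ) :=
    { toFun := fun g j₀ => ∑ i, g i * D j₀ (v i)
      map_add' := fun g h => by
        funext j₀
        simp only [Pi.add_apply, add_mul, Finset.sum_add_distrib]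
      map_smul' := fun c g => by
        funext j₀
        simp only [Pi.smul_apply, smul_eq_mul, RingHom.id_apply, Finset.mul_sum, mul_assoc] }
  have hΦ : ∀ g j₀, Φ g j₀ = ∑ i, g i * D j₀ (v i) := fun _ _ => rfl
  -- the gradients lie in `ker Φ` (chain rule)
  have hker : ∀ j, (fun i : σ => MvPolynomial.aeval v (MvPolynomial.pderiv i (P j))) ∈
      LinearMap.ker Φ := by
    intro j
    rw [LinearMap.mem_ker]
    funext j₀
    rw [hΦ, Pi.zero_apply]
    have h1 := derivation_mvPolynomial_aeval ((D j₀).restrictScalars ℤ) v (P j)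
    simp only [Derivation.restrictScalars_apply, hP j, map_zero, smul_eq_mul] at h1
    exact h1.symm
  -- `Φ` is onto: `Φ (e_{l j₁}) = e_{j₁}`
  have hsurj : LinearMap.range Φ = ⊤ := by
    rw [eq_top_iff, ← (Pi.basisFun ℂ J).span_eq, Submodule.span_le]
    rintro _ ⟨j₁, rfl⟩
    refine ⟨Pi.single (l j₁) 1, ?_⟩
    funext j₀
    rw [hΦ, Pi.basisFun_apply, Finset.sum_eq_single (l j₁)]
    · rw [Pi.single_eq_same, one_mul, hl, hD, Pi.single_apply]
      by_cases h : j₁ = j₀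
      · subst h; simp
      · rw [if_neg h, if_neg (Ne.symm h)]
    · intro i _ hi
      rw [Pi.single_eq_of_ne hi, zero_mul]
    · intro h
      exact absurd (Finset.mem_univ _) h
  -- rank–nullity for `Φ`
  have hrn := LinearMap.finrank_range_add_finrank_ker Φ
  rw [hsurj, finrank_top, Module.finrank_fintype_fun_eq_card,
    Module.finrank_fintype_fun_eq_card, hcardJ] at hrn
  -- the `s` gradients are linearly independent inside `ker Φ`
  have hGker : LinearIndependent ℂ (fun j => (⟨_, hker j⟩ : LinearMap.ker Φ)) := by
    apply LinearIndependent.of_comp (LinearMap.ker Φ).subtype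
    exact hG
  have hs : s ≤ Module.finrank ℂ (LinearMap.ker Φ) := by
    simpa using hGker.fintype_card_le_finrank
  omega

/-- **Every counted point is a counterexample to Schanuel's conjecture.**  If `w ∈ ℂ^M` has
`k + 1` ℚ-linearly independent coordinates and `(w, e^w)` satisfies `s` integer polynomial
relations with `2M ≤ s + k` and ℂ-linearly independent gradients, then Schanuel's conjecture
fails: by the Jacobian criterion `trdeg ℚ(w, e^w) ≤ 2M − s ≤ k`, while Schanuel at the
independent sub-tuple (and monotonicity of `trdeg` along `ℚ(w∘f, e^{w∘f}) ⊆ ℚ(w, e^w)`) gives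
`k + 1 ≤ trdeg`.  This is the "counted ⇒ counterexample" half of the route's kill criterion (i),
for every level `k` (so for `CountingGapHigher`, `CountingGapPair` and `Amplification` alike).
[cite: Lang1966, pp. 30–31] [folklore] -/
theorem not_schanuel_of_counted {k M : ℕ} {w : Fin M → ℂ}
    (hli : ∃ f : Fin (k + 1) ↪ Fin M, LinearIndependent ℚ (w ∘ f))
    {s : ℕ} {P : Fin s → MvPolynomial (Fin M ⊕ Fin M) ℤ} (hs : 2 * M ≤ s + k)
    (hP : ∀ j, MvPolynomial.aeval (Sum.elim w (cexp ∘ w)) (P j) = 0)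
    (hG : LinearIndependent ℂ (fun j => fun i : Fin M ⊕ Fin M =>
      MvPolynomial.aeval (Sum.elim w (cexp ∘ w)) (MvPolynomial.pderiv i (P j)))) :
    ¬ _root_.Schanuel := by
  classical
  intro hS
  obtain ⟨f, hf⟩ := hli
  set v : Fin M ⊕ Fin M → ℂ := Sum.elim w (cexp ∘ w) with hv
  -- Schanuel at the independent sub-tuple `w ∘ f`
  have h1 : ((k + 1 : ℕ) : Cardinal) ≤ Algebra.trdeg ℚ
      ↥(IntermediateField.adjoin ℚ (range (w ∘ f) ∪ range (cexp ∘ (w ∘ f)))) :=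
    hS (k + 1) (w ∘ f) hf
  -- monotonicity along `ℚ(w ∘ f, e^{w ∘ f}) ⊆ ℚ(w, e^w)`, through the algebraic matroid
  have hsub : range (w ∘ f) ∪ range (cexp ∘ (w ∘ f)) ⊆ range v := by
    rintro z (⟨i, rfl⟩ | ⟨i, rfl⟩)
    · exact ⟨Sum.inl (f i), rfl⟩
    · exact ⟨Sum.inr (f i), rfl⟩
  have h2 : ((k + 1 : ℕ) : ℕ∞) ≤ (GammaField.algMatroid ℂ).eRk (range v) :=
    (ZilberHomogeneity.natCast_le_eRk_of_le_trdeg h1).trans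
      ((GammaField.algMatroid ℂ).eRk_mono hsub)
  have h3 : ((k + 1 : ℕ) : Cardinal) ≤
      Algebra.trdeg ℚ ↥(IntermediateField.adjoin ℚ (range v)) :=
    le_trdeg_adjoin_of_natCast_le_eRk h2
  -- the Jacobian criterion
  have h4 := natCast_add_le_card_of_jacobian v P hP hG h3
  simp only [Fintype.card_sum, Fintype.card_fin] at h4
  omega

end Summit.Schanuel.Schanuel.Theorems.CountingGapHigher.Negative

end
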